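import Summits.CriticalPhenomena.PercolationContinuityZ3.Theorems.PercNearOneGluingNoHeavyConstsChernoffCount
import Literature.Computability.Complexity.GaussIntegralFP
import HarnessLib

/-!
# The star case of (LT³⁄₂), leaf observer: the two-integer inequality at the sharpened threshold

builds on p205010 (kernel theorem, internal audit signed; external expert review pending)

PAPER-2 track "percolation constants", part (ii), seat `prim-consts-1`, gen 9 (lane index `run/shared/lean/prim/consts/CONSTANTS.md`,
row A19; memo `FROM-prim-consts-1-g8-ROOTED-SPLIT.md` §6b step (v')).  Support file for the crux `NoHeavyLowerTail`
(stmt-CriticalPhenomena-4575; `--supports … --as helper`): theorems only, no definitions, no sorries, standard axioms.  Companion of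
`…ConstsChernoffStar` (centre observer); the probability-level assembly is `…ConstsChernoffLeaf`.

WHY.  On a star with `K` relay leaves of mean closing probability `x`, when the OBSERVER IS ITSELF A RELAY LEAF `ℓ` the bad event
`{1 ≤ N < (2/3)·EN}` splits as `{spoke ℓ closed}` (mass `q_ℓ`) plus `{spoke ℓ open, L ≥ t⁺}` where `L` counts the closed spokes of the
OTHER relay leaves and the threshold is SHARPER by `1/3` (the observer counts itself): `t⁺` = least integer `> K/3 + 2xK/3 + 1/3`.
Since `s ≥ max(q_ℓ + (1 − q_ℓ)x, 2x − x²)`, the bound `P(bad) ≤ (3/2)s` follows from `P(L ≥ t⁺) ≤ G(x) := x(2 − 3x/2)/(1 − x)` (the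
function with `x + (1 − x)G(x) = (3/2)(2x − x²)`); with the plain threshold the estimate fails (ratio `1.01` at `K = 5`).  As in
the centre case, the large-deviation bound `B(K,t,x) = (K/t)^t (K/m)^m x^t (1−x)^m` of `…ConstsChernoffCount` is compared with `G` at
the largest admissible mean `y_t = (3t − K − 1)/(2K)`, where `B(K,t,y_t) = ((3t−K−1)/(2t))^t ((3m+1)/(2m))^m` (`m = K − t`),
leaving the TWO-INTEGER INEQUALITY proved here:
    `((3t−K−1)/(2t))^t ((3m+1)/(2m))^m ≤ y_t (2 − 3y_t/2)/(1 − y_t)`,  `K ≥ 5`, `(K+2)/3 ≤ t ≤ K − 1`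
(numerically max ratio `0.576` at `(K,t) = (5,3)`; checked for `K ≤ 3000`).  PROOF: `K ≤ 100` by exact rational arithmetic
(`Consts.leaf_ineq_small`, exactly 3 264 in-range instances `(K,t)`); `K > 100`, `3t − K − 1 ≤ 9K/10` analytically: cube and use `(1 + 1/(3m))^{3m} ≤ 3`
(`Literature.Computability.Complexity.GaussIntegral.one_add_inv_pow_le_three`, the only place the exponential function enters) to get
`F⁺³ ≤ 3·(27/8)^K·((3t−K−1)/(3t))^{3t}` (`Consts.leaf_cube_le`), then the five pieces in `(3t−K−1)/K` and the small piece of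
`…ConstsChernoffStar`, mutatis mutandis (`Consts.leaf_piece`, `Consts.leaf_small_piece`, `Consts.leaf_rhs_lower`, `Consts.leaf_ineq_tail`,
`Consts.leaf_ineq`).
References: G. Grimmett, *Percolation* (1999), §2.2; W. Hoeffding, J. Amer. Statist. Assoc. 58 (1963) 13–30.
-/

noncomputable section

namespace Summit.CriticalPhenomena.PercolationContinuityZ3.Theorems

open MeasureTheory Set Literature.Probability.LatticeModels Literature.Probability.Percolation
open scoped Classical

namespace Consts

/-! ### The leaf two-integer inequality for `K ≤ 100`: exact rational arithmetic -/

set_option maxHeartbeats 8000000 in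
/-- **`F⁺(K,t) ≤ y_t(2 − 3y_t/2)/(1 − y_t)` for `5 ≤ K ≤ 100` and all `(K+2)/3 ≤ t < K`** — exactly 3 264 in-range rational instances `(K,t)` by `norm_num`.
[folklore] -/
theorem leaf_ineq_small (K t : ℕ) (h5 : 5 ≤ K) (hK : K ≤ 100) (h3 : K + 2 ≤ 3 * t) (htK : t < K) :
    (((3 * t - K - 1 : ℕ) : ℝ) / (2 * t)) ^ t * ((3 * ((K - t : ℕ) : ℝ) + 1) / (2 * ((K - t : ℕ) : ℝ))) ^ (K - t) ≤
      ((3 * t - K - 1 : ℕ) : ℝ) / (2 * K) * (2 - 3 * (((3 * t - K - 1 : ℕ) : ℝ) / (2 * K)) / 2) /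
        (1 - ((3 * t - K - 1 : ℕ) : ℝ) / (2 * K)) := by
  have ht_lo : 3 ≤ t := by omega
  interval_cases K <;> interval_cases t <;> norm_num

/-! ### The leaf two-integer inequality for `K > 100`: cube bound, five pieces and the small piece -/

/-- **Cube bound**: `F⁺(K,t)³ ≤ 3 · (27/8)^K · ((3t−K−1)/(3t))^{3t}`, using `((3m+1)/(2m))^{3m} = (3/2)^{3m}(1 + 1/(3m))^{3m} ≤ 3(3/2)^{3m}`.
[folklore] -/
theorem leaf_cube_le (K t : ℕ) (h3 : K + 2 ≤ 3 * t) (htK : t + 1 ≤ K) :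
    ((((3 * t - K - 1 : ℕ) : ℝ) / (2 * t)) ^ t * ((3 * ((K - t : ℕ) : ℝ) + 1) / (2 * ((K - t : ℕ) : ℝ))) ^ (K - t)) ^ 3 ≤
      3 * ((27 : ℝ) / 8) ^ K * (((3 * t - K - 1 : ℕ) : ℝ) / (3 * t)) ^ (3 * t) := by
  set u : ℕ := 3 * t - K - 1 with hu
  set m : ℕ := K - t with hm
  have ht : (0 : ℝ) < t := by exact_mod_cast (show 0 < t by omega)
  have hm0 : 0 < m := by omega
  have hmR : (0 : ℝ) < m := by exact_mod_cast hm0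
  have hu0 : (0 : ℝ) ≤ u := by exact_mod_cast Nat.zero_le u
  have hKt : m + t = K := by omega
  rw [mul_pow, ← pow_mul, ← pow_mul]
  -- first factor: (u/(2t))^(3t) = (3/2)^(3t) (u/(3t))^(3t)
  have e1 : (((u : ℕ) : ℝ) / (2 * t)) ^ (t * 3) = ((3 : ℝ) / 2) ^ (3 * t) * (((u : ℕ) : ℝ) / (3 * t)) ^ (3 * t) := by
    rw [← mul_pow, mul_comm t 3]
    congr 1
    field_simp
  -- second factor: ((3m+1)/(2m))^(3m) = (3/2)^(3m) (1 + 1/(3m))^(3m) ≤ 3 (3/2)^(3m)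
  have e2 : ((3 * (m : ℝ) + 1) / (2 * (m : ℝ))) ^ (m * 3) = ((3 : ℝ) / 2) ^ (3 * m) * (1 + 1 / ((3 * m : ℕ) : ℝ)) ^ (3 * m) := by
    rw [← mul_pow, mul_comm m 3]
    congr 1
    push_cast
    field_simp
  have h2 : ((3 * (m : ℝ) + 1) / (2 * (m : ℝ))) ^ (m * 3) ≤ ((3 : ℝ) / 2) ^ (3 * m) * 3 := by
    rw [e2]
    exact mul_le_mul_of_nonneg_left (Literature.Computability.Complexity.GaussIntegral.one_add_inv_pow_le_three (3 * m) (by omega)) (pow_nonneg (by norm_num) _)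
  have h1nonneg : 0 ≤ (((u : ℕ) : ℝ) / (2 * t)) ^ (t * 3) := pow_nonneg (div_nonneg hu0 (by linarith)) _
  calc (((u : ℕ) : ℝ) / (2 * t)) ^ (t * 3) * ((3 * (m : ℝ) + 1) / (2 * (m : ℝ))) ^ (m * 3)
      ≤ (((u : ℕ) : ℝ) / (2 * t)) ^ (t * 3) * (((3 : ℝ) / 2) ^ (3 * m) * 3) := mul_le_mul_of_nonneg_left h2 h1nonneg
    _ = 3 * (((3 : ℝ) / 2) ^ (3 * t) * ((3 : ℝ) / 2) ^ (3 * m)) * (((u : ℕ) : ℝ) / (3 * t)) ^ (3 * t) := by rw [e1]; ring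
    _ = 3 * ((27 : ℝ) / 8) ^ K * (((u : ℕ) : ℝ) / (3 * t)) ^ (3 * t) := by
        rw [← pow_add, show 3 * t + 3 * m = 3 * K by omega, pow_mul]; norm_num

/-- **Generic piece** of the analytic tail (leaf version): on `v₀K ≤ u ≤ v₁K` (`u = 3t−K−1`, `v₀ = num₀/den₀`, `v₁ = nv₁/dv₁`), with
`q ≥ v₁/(1+v₁)`, `c ≥ (27/8)^{den₀} q^{den₀+num₀}`, `c ≤ 1`, `3^{den₀} c^100 ≤ (r³)^{den₀}` and `r ≤` the right-hand side, one gets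
`F⁺(K,t) ≤` right-hand side for `K ≥ 100` (all in natural powers: `(F⁺³)^{den₀} ≤ 3^{den₀} c^K ≤ 3^{den₀} c^100`). [folklore] -/
theorem leaf_piece (K t : ℕ) (hK : 100 ≤ K) (h3 : K + 2 ≤ 3 * t) (htK : t + 1 ≤ K)
    (q c r : ℝ) (num₀ den₀ nv₁ dv₁ : ℕ) (hden : 0 < den₀) (hdv : 0 < dv₁)
    (hq0 : 0 ≤ q) (hq1 : q ≤ 1)
    (hlo : num₀ * K ≤ den₀ * (3 * t - K - 1)) (hhi : dv₁ * (3 * t - K - 1) ≤ nv₁ * K)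
    (hqv : (nv₁ : ℝ) ≤ q * (nv₁ + dv₁))
    (hc : ((27 : ℝ) / 8) ^ den₀ * q ^ (den₀ + num₀) ≤ c) (hc0 : 0 ≤ c) (hc1 : c ≤ 1)
    (hcr : (3 : ℝ) ^ den₀ * c ^ 100 ≤ (r ^ 3) ^ den₀) (hr0 : 0 ≤ r)
    (hrR : r ≤ ((3 * t - K - 1 : ℕ) : ℝ) / (2 * K) * (2 - 3 * (((3 * t - K - 1 : ℕ) : ℝ) / (2 * K)) / 2) /
        (1 - ((3 * t - K - 1 : ℕ) : ℝ) / (2 * K))) :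
    (((3 * t - K - 1 : ℕ) : ℝ) / (2 * t)) ^ t * ((3 * ((K - t : ℕ) : ℝ) + 1) / (2 * ((K - t : ℕ) : ℝ))) ^ (K - t) ≤
      ((3 * t - K - 1 : ℕ) : ℝ) / (2 * K) * (2 - 3 * (((3 * t - K - 1 : ℕ) : ℝ) / (2 * K)) / 2) /
        (1 - ((3 * t - K - 1 : ℕ) : ℝ) / (2 * K)) := by
  set u : ℕ := 3 * t - K - 1 with hu
  set F : ℝ := (((u : ℕ) : ℝ) / (2 * t)) ^ t * ((3 * ((K - t : ℕ) : ℝ) + 1) / (2 * ((K - t : ℕ) : ℝ))) ^ (K - t) with hF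
  have hu3 : 3 * t = K + u + 1 := by omega
  have ht0 : (0 : ℝ) < t := by exact_mod_cast (show 0 < t by omega)
  have hK0 : (0 : ℝ) < K := by exact_mod_cast (show 0 < K by omega)
  have hu0 : (0 : ℝ) ≤ u := by exact_mod_cast Nat.zero_le u
  have hmR : (0 : ℝ) ≤ ((K - t : ℕ) : ℝ) := by exact_mod_cast Nat.zero_le _
  have hF0 : 0 ≤ F :=
    mul_nonneg (pow_nonneg (div_nonneg hu0 (by linarith)) _) (pow_nonneg (div_nonneg (by linarith) (by linarith)) _)
  -- F^3 ≤ 3 (27/8)^K (u/(3t))^(3t)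
  have hcube : F ^ 3 ≤ 3 * ((27 : ℝ) / 8) ^ K * (((u : ℕ) : ℝ) / (3 * t)) ^ (3 * t) := leaf_cube_le K t h3 htK
  -- u/(3t) ≤ q
  have hratio : ((u : ℕ) : ℝ) / (3 * t) ≤ q := by
    rw [div_le_iff₀ (by linarith)]
    have h1 : ((dv₁ : ℕ) : ℝ) * u ≤ nv₁ * K := by exact_mod_cast hhi
    have h2 : (3 : ℝ) * t = K + u + 1 := by exact_mod_cast hu3
    rw [h2]
    have hdvR : (0 : ℝ) < dv₁ := by exact_mod_cast hdv
    have hnv : (0 : ℝ) ≤ nv₁ := by exact_mod_cast Nat.zero_le _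
    have hsum : (0 : ℝ) < nv₁ + dv₁ := by linarith
    have k1 : ((u : ℕ) : ℝ) * (nv₁ + dv₁) ≤ nv₁ * (K + u + 1) := by nlinarith
    have k2 : (nv₁ : ℝ) * (K + u + 1) ≤ q * (nv₁ + dv₁) * (K + u + 1) :=
      mul_le_mul_of_nonneg_right hqv (by linarith)
    have k3 : ((u : ℕ) : ℝ) * (nv₁ + dv₁) ≤ (q * (K + u + 1)) * (nv₁ + dv₁) := by nlinarith
    exact le_of_mul_le_mul_right k3 hsum
  have hratio0 : 0 ≤ ((u : ℕ) : ℝ) / (3 * t) := div_nonneg hu0 (by linarith)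
  -- (u/3t)^(3t) ≤ q^(K+u+1) ≤ q^(K+u) = q^K * q^u
  have hpow1 : (((u : ℕ) : ℝ) / (3 * t)) ^ (3 * t) ≤ q ^ K * q ^ u := by
    rw [hu3, ← pow_add]
    exact (pow_le_pow_left₀ hratio0 hratio _).trans (pow_le_pow_of_le_one hq0 hq1 (by omega))
  -- (q^u)^den₀ ≤ q^(num₀ K)
  have hpow2 : (q ^ u) ^ den₀ ≤ q ^ (num₀ * K) := by
    rw [← pow_mul]
    exact pow_le_pow_of_le_one hq0 hq1 (le_of_le_of_eq hlo (mul_comm _ _))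
  -- (F^3)^den₀ ≤ 3^den₀ c^K
  have h278 : (0 : ℝ) ≤ ((27 : ℝ) / 8) ^ K := pow_nonneg (by norm_num) _
  have hstep : (F ^ 3) ^ den₀ ≤ (3 : ℝ) ^ den₀ * c ^ K := by
    calc (F ^ 3) ^ den₀ ≤ (3 * ((27 : ℝ) / 8) ^ K * (((u : ℕ) : ℝ) / (3 * t)) ^ (3 * t)) ^ den₀ :=
          pow_le_pow_left₀ (pow_nonneg hF0 3) hcube _
      _ ≤ (3 * ((27 : ℝ) / 8) ^ K * (q ^ K * q ^ u)) ^ den₀ :=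
          pow_le_pow_left₀ (mul_nonneg (mul_nonneg (by norm_num) h278) (pow_nonneg hratio0 _))
            (mul_le_mul_of_nonneg_left hpow1 (mul_nonneg (by norm_num) h278)) _
      _ = (3 : ℝ) ^ den₀ * ((((27 : ℝ) / 8) ^ den₀ * q ^ den₀) ^ K * (q ^ u) ^ den₀) := by ring
      _ ≤ (3 : ℝ) ^ den₀ * ((((27 : ℝ) / 8) ^ den₀ * q ^ den₀) ^ K * q ^ (num₀ * K)) :=
          mul_le_mul_of_nonneg_left
            (mul_le_mul_of_nonneg_left hpow2 (pow_nonneg (mul_nonneg (pow_nonneg (by norm_num) _) (pow_nonneg hq0 _)) _))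
            (pow_nonneg (by norm_num) _)
      _ = (3 : ℝ) ^ den₀ * (((27 : ℝ) / 8) ^ den₀ * q ^ (den₀ + num₀)) ^ K := by ring
      _ ≤ (3 : ℝ) ^ den₀ * c ^ K :=
          mul_le_mul_of_nonneg_left (pow_le_pow_left₀ (mul_nonneg (pow_nonneg (by norm_num) _) (pow_nonneg hq0 _)) hc _)
            (pow_nonneg (by norm_num) _)
  -- c^K ≤ c^100, then compare with r
  have hcK : c ^ K ≤ c ^ 100 := pow_le_pow_of_le_one hc0 hc1 hK
  have hfin : (F ^ 3) ^ den₀ ≤ (r ^ 3) ^ den₀ :=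
    hstep.trans ((mul_le_mul_of_nonneg_left hcK (pow_nonneg (by norm_num) _)).trans hcr)
  have hF3 : F ^ 3 ≤ r ^ 3 := (pow_le_pow_iff_left₀ (pow_nonneg hF0 3) (pow_nonneg hr0 3) hden.ne').1 hfin
  have hFr : F ≤ r := (pow_le_pow_iff_left₀ hF0 hr0 (by norm_num)).1 hF3
  exact hFr.trans hrR

/-- The right-hand side `G(y) = y(2 − 3y/2)/(1 − y)` is non-decreasing in `y < 1`: on the piece `v₀K ≤ u ≤ v₁K` (`v₁ < 2`) one has
`G(v₀/2) ≤ G(u/(2K))`. [folklore] -/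
theorem leaf_rhs_lower {u K v₀ v₁ : ℝ} (hK0 : 0 < K) (hlo : v₀ * K ≤ u) (hhi : u ≤ v₁ * K) (hv₁ : v₁ < 2) :
    v₀ / 2 * (2 - 3 * (v₀ / 2) / 2) / (1 - v₀ / 2) ≤ u / (2 * K) * (2 - 3 * (u / (2 * K)) / 2) / (1 - u / (2 * K)) := by
  have hw0 : v₀ ≤ u / K := by rw [le_div_iff₀ hK0]; exact hlo
  have hw1 : u / K ≤ v₁ := by rw [div_le_iff₀ hK0]; exact hhi
  have e : u / (2 * K) = (u / K) / 2 := by field_simp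
  rw [e]
  set w := u / K with hw
  have hy1 : 0 < 1 - w / 2 := by linarith
  have hy0 : 0 < 1 - v₀ / 2 := by linarith
  rw [div_le_div_iff₀ hy0 hy1]
  -- (y - y₀)(2 - 3y/2 - 3y₀(1-y)/2) ≥ 0 with y = w/2, y₀ = v₀/2
  have hpos : 0 ≤ 2 - 3 * (w / 2) / 2 - 3 * (v₀ / 2) * (1 - w / 2) / 2 := by nlinarith
  nlinarith [mul_nonneg (sub_nonneg.2 hw0) hpos]

/-- **Small-`u` piece** (leaf version): for `K ≥ 100` and `5u ≤ K` (`u = 3t−K−1`), `F⁺³ ≤ 3(27u/(8K))^K ≤ (u/K)³ ≤ G(y)³`. [folklore] -/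
theorem leaf_small_piece (K t : ℕ) (hK : 100 ≤ K) (h3 : K + 2 ≤ 3 * t) (htK : t + 1 ≤ K) (hsmall : 5 * (3 * t - K - 1) ≤ K) :
    (((3 * t - K - 1 : ℕ) : ℝ) / (2 * t)) ^ t * ((3 * ((K - t : ℕ) : ℝ) + 1) / (2 * ((K - t : ℕ) : ℝ))) ^ (K - t) ≤
      ((3 * t - K - 1 : ℕ) : ℝ) / (2 * K) * (2 - 3 * (((3 * t - K - 1 : ℕ) : ℝ) / (2 * K)) / 2) /
        (1 - ((3 * t - K - 1 : ℕ) : ℝ) / (2 * K)) := by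
  set u : ℕ := 3 * t - K - 1 with hu
  set F : ℝ := (((u : ℕ) : ℝ) / (2 * t)) ^ t * ((3 * ((K - t : ℕ) : ℝ) + 1) / (2 * ((K - t : ℕ) : ℝ))) ^ (K - t) with hF
  have hu3 : 3 * t = K + u + 1 := by omega
  have ht0 : (0 : ℝ) < t := by exact_mod_cast (show 0 < t by omega)
  have hK0 : (0 : ℝ) < K := by exact_mod_cast (show 0 < K by omega)
  have hu0 : (0 : ℝ) ≤ u := by exact_mod_cast Nat.zero_le u
  have huK : ((u : ℕ) : ℝ) * 5 ≤ K := by exact_mod_cast (by omega : u * 5 ≤ K)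
  have hmR : (0 : ℝ) ≤ ((K - t : ℕ) : ℝ) := by exact_mod_cast Nat.zero_le _
  have hF0 : 0 ≤ F :=
    mul_nonneg (pow_nonneg (div_nonneg hu0 (by linarith)) _) (pow_nonneg (div_nonneg (by linarith) (by linarith)) _)
  have hcube : F ^ 3 ≤ 3 * ((27 : ℝ) / 8) ^ K * (((u : ℕ) : ℝ) / (3 * t)) ^ (3 * t) := leaf_cube_le K t h3 htK
  set y : ℝ := ((u : ℕ) : ℝ) / K with hy
  have hy0 : 0 ≤ y := div_nonneg hu0 hK0.le
  have hy1 : y ≤ 1 := by rw [hy, div_le_one hK0]; linarith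
  have hy5 : y ≤ 1 / 5 := by rw [hy, div_le_iff₀ hK0]; linarith
  -- (u/(3t))^(3t) ≤ y^(3t) ≤ y^K
  have hratio : ((u : ℕ) : ℝ) / (3 * t) ≤ y := by
    rw [hy]; exact div_le_div_of_nonneg_left hu0 hK0 (by rw [show (3 : ℝ) * t = K + u + 1 by exact_mod_cast hu3]; linarith)
  have h1 : (((u : ℕ) : ℝ) / (3 * t)) ^ (3 * t) ≤ y ^ K :=
    (pow_le_pow_left₀ (div_nonneg hu0 (by linarith)) hratio _).trans (pow_le_pow_of_le_one hy0 hy1 (by omega))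
  -- F^3 ≤ 3 (27 y / 8)^K ≤ y^3
  have hF3 : F ^ 3 ≤ y ^ 3 := by
    obtain ⟨n, hn⟩ : ∃ n, K = n + 3 := ⟨K - 3, by omega⟩
    have hn97 : 97 ≤ n := by omega
    have hprod : (27 : ℝ) / 8 * y ≤ 27 / 40 := by linarith
    have hprod0 : 0 ≤ (27 : ℝ) / 8 * y := by positivity
    calc F ^ 3 ≤ 3 * ((27 : ℝ) / 8) ^ K * (((u : ℕ) : ℝ) / (3 * t)) ^ (3 * t) := hcube
      _ ≤ 3 * ((27 : ℝ) / 8) ^ K * y ^ K := mul_le_mul_of_nonneg_left h1 (by positivity)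
      _ = 3 * (((27 : ℝ) / 8 * y) ^ 3 * ((27 : ℝ) / 8 * y) ^ n) := by rw [hn, mul_pow, mul_pow]; ring
      _ ≤ 3 * (((27 : ℝ) / 8 * y) ^ 3 * ((27 : ℝ) / 40) ^ n) :=
          mul_le_mul_of_nonneg_left (mul_le_mul_of_nonneg_left (pow_le_pow_left₀ hprod0 hprod n) (by positivity)) (by norm_num)
      _ ≤ 3 * (((27 : ℝ) / 8 * y) ^ 3 * ((27 : ℝ) / 40) ^ 97) := by
          refine mul_le_mul_of_nonneg_left (mul_le_mul_of_nonneg_left ?_ (by positivity)) (by norm_num)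
          exact pow_le_pow_of_le_one (by norm_num) (by norm_num) hn97
      _ = (3 * ((27 : ℝ) / 8) ^ 3 * ((27 : ℝ) / 40) ^ 97) * y ^ 3 := by ring
      _ ≤ 1 * y ^ 3 := mul_le_mul_of_nonneg_right (by norm_num) (pow_nonneg hy0 3)
      _ = y ^ 3 := one_mul _
  -- y ≤ G(y/2) = RHS
  set R : ℝ := ((u : ℕ) : ℝ) / (2 * K) * (2 - 3 * (((u : ℕ) : ℝ) / (2 * K)) / 2) / (1 - ((u : ℕ) : ℝ) / (2 * K)) with hR
  have hR' : R = (y / 2) * (2 - 3 * (y / 2) / 2) / (1 - y / 2) := by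
    rw [hR, hy]
    have : ((u : ℕ) : ℝ) / (2 * K) = ((u : ℕ) : ℝ) / K / 2 := by field_simp
    rw [this]
  have hden : 0 < 1 - y / 2 := by linarith
  have hyR : y ≤ R := by
    rw [hR', le_div_iff₀ hden]
    nlinarith
  have hR0 : 0 ≤ R := hy0.trans hyR
  exact (pow_le_pow_iff_left₀ hF0 hR0 (by norm_num)).1 (hF3.trans (pow_le_pow_left₀ hy0 hyR 3))

/-- **`F⁺(K,t) ≤ G(y_t)` for `K > 100` and `3t − K − 1 ≤ 9K/10`**, assembled from the small piece and the five pieces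
`[1/5,3/10], [3/10,9/20], [9/20,3/5], [3/5,3/4], [3/4,9/10]` of `(3t−K−1)/K` (the case `K ≤ 100` is a hypothesis; see `Consts.leaf_ineq`).
[folklore] -/
theorem leaf_ineq_tail (K t : ℕ) (h3 : K + 2 ≤ 3 * t) (htK : t + 1 ≤ K) (hrange : 10 * (3 * t - K - 1) ≤ 9 * K)
    (small : K ≤ 100 →
      (((3 * t - K - 1 : ℕ) : ℝ) / (2 * t)) ^ t * ((3 * ((K - t : ℕ) : ℝ) + 1) / (2 * ((K - t : ℕ) : ℝ))) ^ (K - t) ≤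
      ((3 * t - K - 1 : ℕ) : ℝ) / (2 * K) * (2 - 3 * (((3 * t - K - 1 : ℕ) : ℝ) / (2 * K)) / 2) /
        (1 - ((3 * t - K - 1 : ℕ) : ℝ) / (2 * K))) :
    (((3 * t - K - 1 : ℕ) : ℝ) / (2 * t)) ^ t * ((3 * ((K - t : ℕ) : ℝ) + 1) / (2 * ((K - t : ℕ) : ℝ))) ^ (K - t) ≤
      ((3 * t - K - 1 : ℕ) : ℝ) / (2 * K) * (2 - 3 * (((3 * t - K - 1 : ℕ) : ℝ) / (2 * K)) / 2) /
        (1 - ((3 * t - K - 1 : ℕ) : ℝ) / (2 * K)) := by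
  by_cases hK : K ≤ 100
  · exact small hK
  have hK100 : 100 ≤ K := by omega
  set u : ℕ := 3 * t - K - 1 with hu
  have hK0 : (0 : ℝ) < K := by exact_mod_cast (show 0 < K by omega)
  by_cases c0 : 5 * u ≤ K
  · exact leaf_small_piece K t hK100 h3 htK c0
  by_cases c1 : 10 * u ≤ 3 * K
  · have hlo0 : (1 : ℝ) / 5 * K ≤ ((u : ℕ) : ℝ) := by
      have h : ((1 : ℕ) : ℝ) * K ≤ (5 : ℕ) * u := by exact_mod_cast (show 1 * K ≤ 5 * u by omega)
      push_cast at h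
      rw [div_mul_eq_mul_div, div_le_iff₀ (by norm_num : (0:ℝ) < 5)]
      linarith
    have hhi0 : ((u : ℕ) : ℝ) ≤ (3 : ℝ) / 10 * K := by
      have h : ((10 : ℕ) : ℝ) * u ≤ (3 : ℕ) * K := by exact_mod_cast c1
      push_cast at h
      rw [div_mul_eq_mul_div, le_div_iff₀ (by norm_num : (0:ℝ) < 10)]
      linarith
    exact leaf_piece K t hK100 h3 htK (3 / 13) (((27 : ℝ) / 8) ^ 5 * ((3 / 13 : ℝ)) ^ (5 + 1))
      ((1 : ℝ) / 5 / 2 * (2 - 3 * ((1 : ℝ) / 5 / 2) / 2) / (1 - (1 : ℝ) / 5 / 2)) 1 5 3 10 (by norm_num) (by norm_num)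
      (by norm_num) (by norm_num) (by omega) c1 (by norm_num) le_rfl (by positivity) (by norm_num) (by norm_num) (by norm_num)
      (leaf_rhs_lower hK0 hlo0 hhi0 (by norm_num))
  by_cases c2 : 20 * u ≤ 9 * K
  · have hlo1 : (3 : ℝ) / 10 * K ≤ ((u : ℕ) : ℝ) := by
      have h : ((3 : ℕ) : ℝ) * K ≤ (10 : ℕ) * u := by exact_mod_cast (show 3 * K ≤ 10 * u by omega)
      push_cast at h
      rw [div_mul_eq_mul_div, div_le_iff₀ (by norm_num : (0:ℝ) < 10)]
      linarith
    have hhi1 : ((u : ℕ) : ℝ) ≤ (9 : ℝ) / 20 * K := by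
      have h : ((20 : ℕ) : ℝ) * u ≤ (9 : ℕ) * K := by exact_mod_cast c2
      push_cast at h
      rw [div_mul_eq_mul_div, le_div_iff₀ (by norm_num : (0:ℝ) < 20)]
      linarith
    exact leaf_piece K t hK100 h3 htK (9 / 29) (((27 : ℝ) / 8) ^ 10 * ((9 / 29 : ℝ)) ^ (10 + 3))
      ((3 : ℝ) / 10 / 2 * (2 - 3 * ((3 : ℝ) / 10 / 2) / 2) / (1 - (3 : ℝ) / 10 / 2)) 3 10 9 20 (by norm_num) (by norm_num)
      (by norm_num) (by norm_num) (by omega) c2 (by norm_num) le_rfl (by positivity) (by norm_num) (by norm_num) (by norm_num)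
      (leaf_rhs_lower hK0 hlo1 hhi1 (by norm_num))
  by_cases c3 : 5 * u ≤ 3 * K
  · have hlo2 : (9 : ℝ) / 20 * K ≤ ((u : ℕ) : ℝ) := by
      have h : ((9 : ℕ) : ℝ) * K ≤ (20 : ℕ) * u := by exact_mod_cast (show 9 * K ≤ 20 * u by omega)
      push_cast at h
      rw [div_mul_eq_mul_div, div_le_iff₀ (by norm_num : (0:ℝ) < 20)]
      linarith
    have hhi2 : ((u : ℕ) : ℝ) ≤ (3 : ℝ) / 5 * K := by
      have h : ((5 : ℕ) : ℝ) * u ≤ (3 : ℕ) * K := by exact_mod_cast c3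
      push_cast at h
      rw [div_mul_eq_mul_div, le_div_iff₀ (by norm_num : (0:ℝ) < 5)]
      linarith
    exact leaf_piece K t hK100 h3 htK (3 / 8) (((27 : ℝ) / 8) ^ 20 * ((3 / 8 : ℝ)) ^ (20 + 9))
      ((9 : ℝ) / 20 / 2 * (2 - 3 * ((9 : ℝ) / 20 / 2) / 2) / (1 - (9 : ℝ) / 20 / 2)) 9 20 3 5 (by norm_num) (by norm_num)
      (by norm_num) (by norm_num) (by omega) c3 (by norm_num) le_rfl (by positivity) (by norm_num) (by norm_num) (by norm_num)
      (leaf_rhs_lower hK0 hlo2 hhi2 (by norm_num))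
  by_cases c4 : 4 * u ≤ 3 * K
  · have hlo3 : (3 : ℝ) / 5 * K ≤ ((u : ℕ) : ℝ) := by
      have h : ((3 : ℕ) : ℝ) * K ≤ (5 : ℕ) * u := by exact_mod_cast (show 3 * K ≤ 5 * u by omega)
      push_cast at h
      rw [div_mul_eq_mul_div, div_le_iff₀ (by norm_num : (0:ℝ) < 5)]
      linarith
    have hhi3 : ((u : ℕ) : ℝ) ≤ (3 : ℝ) / 4 * K := by
      have h : ((4 : ℕ) : ℝ) * u ≤ (3 : ℕ) * K := by exact_mod_cast c4
      push_cast at h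
      rw [div_mul_eq_mul_div, le_div_iff₀ (by norm_num : (0:ℝ) < 4)]
      linarith
    exact leaf_piece K t hK100 h3 htK (3 / 7) (((27 : ℝ) / 8) ^ 5 * ((3 / 7 : ℝ)) ^ (5 + 3))
      ((3 : ℝ) / 5 / 2 * (2 - 3 * ((3 : ℝ) / 5 / 2) / 2) / (1 - (3 : ℝ) / 5 / 2)) 3 5 3 4 (by norm_num) (by norm_num)
      (by norm_num) (by norm_num) (by omega) c4 (by norm_num) le_rfl (by positivity) (by norm_num) (by norm_num) (by norm_num)
      (leaf_rhs_lower hK0 hlo3 hhi3 (by norm_num))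
  have hlo4 : (3 : ℝ) / 4 * K ≤ ((u : ℕ) : ℝ) := by
    have h : ((3 : ℕ) : ℝ) * K ≤ (4 : ℕ) * u := by exact_mod_cast (show 3 * K ≤ 4 * u by omega)
    push_cast at h
    rw [div_mul_eq_mul_div, div_le_iff₀ (by norm_num : (0:ℝ) < 4)]
    linarith
  have hhi4 : ((u : ℕ) : ℝ) ≤ (9 : ℝ) / 10 * K := by
    have h : ((10 : ℕ) : ℝ) * u ≤ (9 : ℕ) * K := by exact_mod_cast (show 10 * u ≤ 9 * K by omega)
    push_cast at h
    rw [div_mul_eq_mul_div, le_div_iff₀ (by norm_num : (0:ℝ) < 10)]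
    linarith
  exact leaf_piece K t hK100 h3 htK (9 / 19) (((27 : ℝ) / 8) ^ 4 * ((9 / 19 : ℝ)) ^ (4 + 3))
    ((3 : ℝ) / 4 / 2 * (2 - 3 * ((3 : ℝ) / 4 / 2) / 2) / (1 - (3 : ℝ) / 4 / 2)) 3 4 9 10 (by norm_num) (by norm_num)
    (by norm_num) (by norm_num) (by omega) (by omega) (by norm_num) le_rfl (by positivity) (by norm_num) (by norm_num) (by norm_num)
    (leaf_rhs_lower hK0 hlo4 hhi4 (by norm_num))

/-- **The leaf two-integer inequality** (memo §6b step (v')): for all `K ≥ 5`, `(K+2)/3 ≤ t < K` with `3t − K − 1 ≤ 9K/10`,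
`((3t−K−1)/(2t))^t ((3(K−t)+1)/(2(K−t)))^{K−t} ≤ y_t(2 − 3y_t/2)/(1 − y_t)`, `y_t = (3t−K−1)/(2K)`. [folklore] -/
theorem leaf_ineq (K t : ℕ) (h5 : 5 ≤ K) (h3 : K + 2 ≤ 3 * t) (htK : t + 1 ≤ K) (hrange : 10 * (3 * t - K - 1) ≤ 9 * K) :
    (((3 * t - K - 1 : ℕ) : ℝ) / (2 * t)) ^ t * ((3 * ((K - t : ℕ) : ℝ) + 1) / (2 * ((K - t : ℕ) : ℝ))) ^ (K - t) ≤
      ((3 * t - K - 1 : ℕ) : ℝ) / (2 * K) * (2 - 3 * (((3 * t - K - 1 : ℕ) : ℝ) / (2 * K)) / 2) /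
        (1 - ((3 * t - K - 1 : ℕ) : ℝ) / (2 * K)) :=
  leaf_ineq_tail K t h3 htK hrange fun hK => leaf_ineq_small K t h5 hK h3 (by omega)

end Consts

end Summit.CriticalPhenomena.PercolationContinuityZ3.Theorems
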